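import Summits.BirchSwinnertonDyer.BirchSwinnertonDyer.Theorems.ManinLocalTwoThreeManinConstantFourteen
import Summits.BirchSwinnertonDyer.BirchSwinnertonDyer.Theorems.ManinLocalTwoThreeManinConstantFifteen
import Summits.BirchSwinnertonDyer.BirchSwinnertonDyer.Theorems.ManinLocalTwoThreeDyadicTwistFamiliesFactFree
import HarnessLib

/-!
# Two new ROOTS for the fact-free twist families: the semistable genus-one levels `14` and `15`

Cell bsd-f2-manin, route `ManinLocalTwoThree` (cruxes C2 `ManinOddAtFour` stmt-22967 / C3 `ManinPrimeToThreeAtNine` stmt-22968),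
prover seat p3 gen 25.  The tree's twist engines (planner -desc, THEOREMS 68.A–C / 69.A–C, files `…TwistFamiliesFactFree`,
`…DyadicTwistFamiliesFactFree`) turn every FACT-FREE COMPLETE LEVEL `M` (`LevelManinOne M`: `|c| = 1` for every
lattice-optimal `X₀(M)`-datum of every globally minimal curve) into infinite families of ADDITIVE levels on which `|c| = 1`
(hence `2 ∤ c`, `3 ∤ c`) holds with no printed fact: the odd-`p` twist images (`TwistLevelManinOne M p`) and the dyadic
twist images (`DyadicTwistLevelManinOne M d`, `d ∈ {−1, ±2}`).  So far every root was itself an additive level.  This file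
feeds the engines the two SEMISTABLE roots `M = 14` and `M = 15` (this seat's `LevelFourteen.abs_maninConstant_eq_one_fourteen`,
`LevelFifteen.abs_maninConstant_eq_one_fifteen`, weight-4 E₂ road + analytic bridge + Néron squeeze), whose twist images are
the first additive appearances of the classes `14a` and `15a`:

* §1 `LevelManinOne 14`, `LevelManinOne 15`; `TwistLevelManinOne 14 p`, `TwistLevelManinOne 15 p` (every odd `p`);
  `DyadicTwistLevelManinOne 14 d`, `DyadicTwistLevelManinOne 15 d` (`d ∈ {−1, ±2}`); the per-newform closures.
* §2 the crux SHAPES on named members: C2 (`2 ∤ c`) on `14a ⊗ χ₋₄` (`N = 112`, Cremona `112c`), `14a ⊗ χ±8` (`N = 448`),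
  `15a ⊗ χ₋₄` (`N = 240`), `15a ⊗ χ±8` (`N = 960`); C3 (`3 ∤ c`) on `14a ⊗ χ₋₃` (`N = 126 = 2·9·7`) and `15a ⊗ χ₋₃`
  (`N = 135 = 27·5`, `15a` multiplicative at `3`).

HONEST SCOPE.  The statements cover exactly the twist images of the two levels (hypotheses as in the engines: a lattice-optimal
root datum on a curve good-or-multiplicative at the twisting prime, the coefficient relation resp. an isogeny to the twist,
additivity at `2` in the dyadic case).  Nothing here proves C2, C3 (∀ N), the rung, Manin's conjecture or BSD; items 22967/22968
stay OPEN.  No definition, no named fact, no sorry. [cite: Stevens1989, Lemma (5.2), (5.4), (5.6)–(5.7)] [cite: Pal2012, Prop. 2.4]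
[cite: CremonaAlgorithms1997, Table 1 (14a1, 15a1, 112c1, 126a1, 135a1, 240c1)]
-/

set_option autoImplicit false
-- lint-debt: the directory name repeats the summit name (sibling precedent `ManinLocalTwoThreeDyadicTwistFamiliesFactFree.lean`)
set_option linter.dupNamespace false

noncomputable section

open Complex
open scoped MatrixGroups ModularForm
open ModularForm CongruenceSubgroup
open Literature.NumberTheory.EllipticCurves Literature.NumberTheory.EllipticCurves.ModularForms
open Summit.BirchSwinnertonDyer.BirchSwinnertonDyer.Theorems.ManinLocalTwoThree

namespace Summit.BirchSwinnertonDyer.BirchSwinnertonDyer.Theorems.ManinLocalTwoThree.TwistRootsFourteenFifteen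

open WeierstrassCurve TwistFamilies DyadicTwistFamilies

/-! ## §1 The two roots and their families -/

/-- **`LevelManinOne 14`** — level `14 = 2·7` (semistable, genus one, `X₀(14) = 14a1`) is COMPLETE, fact-free (p3 g25, weight-4
E₂ road). [cite: CremonaAlgorithms1997, Table 1 (14a1)] -/
theorem levelManinOne_fourteen : LevelManinOne 14 :=
  fun W _ _ D h ↦ LevelFourteen.abs_maninConstant_eq_one_fourteen W D h

/-- **`LevelManinOne 15`** — level `15 = 3·5` (semistable, genus one, `X₀(15) = 15a1`) is COMPLETE, fact-free (p3 g25, weight-4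
E₂ road). [cite: CremonaAlgorithms1997, Table 1 (15a1)] -/
theorem levelManinOne_fifteen : LevelManinOne 15 :=
  fun W _ _ D h ↦ LevelFifteen.abs_maninConstant_eq_one_fifteen W D h

/-- **`TwistLevelManinOne 14 p` for every odd prime `p`** (THEOREM 68.A on the root `14`): `|c| = 1` on the `χ_p`-twist image of
level `14` — newform levels `14p²` (`p ≠ 7`; at `p = 3` the C3 level `126`), `686 = 14·49` (`p = 7`, `14a` multiplicative at `7`).
[cite: Stevens1989, Lemma (5.2), (5.4)] -/
theorem twistLevelManinOne_fourteen {p : ℕ} [Fact p.Prime] (hp2 : p ≠ 2) : TwistLevelManinOne 14 p :=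
  twistLevelManinOne_of_levelManinOne levelManinOne_fourteen hp2

/-- **`TwistLevelManinOne 15 p` for every odd prime `p`** (THEOREM 68.A on the root `15`): newform levels `15p²`
(at `p = 3` the C3 level `135 = 27·5`, at `p = 5` the level `375`). [cite: Stevens1989, Lemma (5.2), (5.4)] -/
theorem twistLevelManinOne_fifteen {p : ℕ} [Fact p.Prime] (hp2 : p ≠ 2) : TwistLevelManinOne 15 p :=
  twistLevelManinOne_of_levelManinOne levelManinOne_fifteen hp2

/-- **`DyadicTwistLevelManinOne 14 d`, `d ∈ {−1, 2, −2}`** (THEOREM 69.A on the root `14`; Stevens' clause is met because a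
conductor-`14` curve is multiplicative at `2`, or `d = −1`): the C2 levels `112` (`14a ⊗ χ₋₄ = 112c`) and `448` (`χ±8`).
[cite: Stevens1989, Lemma (5.6)–(5.7)] [cite: Pal2012, Prop. 2.4] -/
theorem dyadicTwistLevelManinOne_fourteen {d : ℤ} (hd : d = -1 ∨ d = 2 ∨ d = -2) : DyadicTwistLevelManinOne 14 d :=
  dyadicTwistLevelManinOne_of_levelManinOne levelManinOne_fourteen hd

/-- **`DyadicTwistLevelManinOne 15 d`, `d ∈ {−1, 2, −2}`** (THEOREM 69.A on the ODD root `15`: Stevens' clause `2 ∤ 15` is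
automatic): the C2 levels `240` (`15a ⊗ χ₋₄`) and `960` (`χ±8`). [cite: Stevens1989, Lemma (5.6)–(5.7)] [cite: Pal2012, Prop. 2.4] -/
theorem dyadicTwistLevelManinOne_fifteen {d : ℤ} (hd : d = -1 ∨ d = 2 ∨ d = -2) : DyadicTwistLevelManinOne 15 d :=
  dyadicTwistLevelManinOne_of_levelManinOne levelManinOne_fifteen hd

/-- **Per-newform closure at the root `14`** (THEOREM 68.C): every `χ_p`-twist (`p` odd, the carrier good at `p`) of the newform
of an `X₀(14)`-datum has `NewformManinOne`. [cite: Stevens1989, Lemma (5.2), (5.4)] -/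
theorem newformManinOne_twist_fourteen {p : ℕ} [Fact p.Prime] (hp2 : p ≠ 2)
    {χ : DirichletCharacter ℂ p} (hχ : χ.IsQuadratic) (hprim : χ.IsPrimitive)
    {W₀ : WeierstrassCurve ℚ} [W₀.IsElliptic] (D₀ : ModularParametrizationData W₀ 14)
    (hgood : W₀.HasGoodReductionAtPrime p)
    {N : ℕ} [NeZero N] (hMN : 14 ∣ N) (hpN : p ^ 2 ∣ N) (g' : CuspForm (Gamma0 N) 2)
    (hg' : ∀ n : ℕ, cuspCoeff g' n = χ n * cuspCoeff D₀.f n) : NewformManinOne g' :=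
  newformManinOne_twist_of_levelManinOne levelManinOne_fourteen hp2 hχ hprim D₀ hgood hMN hpN g' hg'

/-- **Per-newform closure at the root `15`** (THEOREM 68.C). [cite: Stevens1989, Lemma (5.2), (5.4)] -/
theorem newformManinOne_twist_fifteen {p : ℕ} [Fact p.Prime] (hp2 : p ≠ 2)
    {χ : DirichletCharacter ℂ p} (hχ : χ.IsQuadratic) (hprim : χ.IsPrimitive)
    {W₀ : WeierstrassCurve ℚ} [W₀.IsElliptic] (D₀ : ModularParametrizationData W₀ 15)
    (hgood : W₀.HasGoodReductionAtPrime p)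
    {N : ℕ} [NeZero N] (hMN : 15 ∣ N) (hpN : p ^ 2 ∣ N) (g' : CuspForm (Gamma0 N) 2)
    (hg' : ∀ n : ℕ, cuspCoeff g' n = χ n * cuspCoeff D₀.f n) : NewformManinOne g' :=
  newformManinOne_twist_of_levelManinOne levelManinOne_fifteen hp2 hχ hprim D₀ hgood hMN hpN g' hg'

/-! ## §2 The crux shapes on named members of the families -/

/-- **C2 on `14a ⊗ χ₋₄` (level `112 = 2⁴·7`, Cremona `112c`)**: `|c(D')| = 1 ∧ 2 ∤ c(D')` (and `3 ∤ c(D')`) for every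
lattice-optimal `X₀(112)`-datum `D'` of a globally minimal `W'` additive at `2` and isogenous to the `−1`-twist of a
`2`-semistable carrier of a lattice-optimal `X₀(14)`-datum.  No printed fact. [cite: CremonaAlgorithms1997, Table 1 (112c1)] -/
theorem shapes_on_family_fourteen_negOne
    (W : WeierstrassCurve ℚ) [W.IsElliptic] [W.IsGloballyMinimal] (D : ModularParametrizationData W 14)
    (hopt : ∀ z ∈ D.L.lattice, ∃ w ∈ periodLattice D.f, z = D.c * w)
    (hsemi : W.HasGoodReductionAtPrime 2 ∨ W.HasMultiplicativeReductionAtPrime 2)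
    (W' : WeierstrassCurve ℚ) [W'.IsElliptic] [W'.IsGloballyMinimal] [NeZero (112 : ℕ)]
    (D' : ModularParametrizationData W' 112)
    (htw : IsIsogenous W' (W.quadraticTwist ((-1 : ℤ) : ℚ)))
    (hadd' : ¬ W'.HasGoodReductionAtPrime 2 ∧ ¬ W'.HasMultiplicativeReductionAtPrime 2)
    (hopt' : ∀ z ∈ D'.L.lattice, ∃ w ∈ periodLattice D'.f, z = D'.c * w) :
    |D'.maninConstant| = 1 ∧ ¬ (2 : ℤ) ∣ D'.maninConstant ∧ ¬ (3 : ℤ) ∣ D'.maninConstant :=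
  shapes_of_dyadicTwistLevelManinOne (dyadicTwistLevelManinOne_fourteen (Or.inl rfl)) W D hopt hsemi
    (Or.inl rfl) W' 112 D' (by norm_num) (by norm_num) htw hadd' hopt'

/-- **C2 on `14a ⊗ χ±8` (level `448 = 2⁶·7`)**: the same on the `±2`-twist image of level `14`, for a carrier MULTIPLICATIVE
at `2` (Stevens' `η`-clause; automatic for a curve of conductor `14`). [cite: Stevens1989, Lemma (5.6)–(5.7)] -/
theorem shapes_on_family_fourteen_two {d : ℤ} (hd : d = 2 ∨ d = -2)
    (W : WeierstrassCurve ℚ) [W.IsElliptic] [W.IsGloballyMinimal] (D : ModularParametrizationData W 14)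
    (hopt : ∀ z ∈ D.L.lattice, ∃ w ∈ periodLattice D.f, z = D.c * w)
    (hmult : W.HasMultiplicativeReductionAtPrime 2)
    (W' : WeierstrassCurve ℚ) [W'.IsElliptic] [W'.IsGloballyMinimal] [NeZero (448 : ℕ)]
    (D' : ModularParametrizationData W' 448)
    (htw : IsIsogenous W' (W.quadraticTwist (d : ℚ)))
    (hadd' : ¬ W'.HasGoodReductionAtPrime 2 ∧ ¬ W'.HasMultiplicativeReductionAtPrime 2)
    (hopt' : ∀ z ∈ D'.L.lattice, ∃ w ∈ periodLattice D'.f, z = D'.c * w) :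
    |D'.maninConstant| = 1 ∧ ¬ (2 : ℤ) ∣ D'.maninConstant ∧ ¬ (3 : ℤ) ∣ D'.maninConstant :=
  have hd3 : d = -1 ∨ d = 2 ∨ d = -2 := Or.inr hd
  have habs : (4 * d.natAbs) ^ 2 = 64 := by rcases hd with rfl | rfl <;> rfl
  shapes_of_dyadicTwistLevelManinOne (dyadicTwistLevelManinOne_fourteen hd3) W D hopt (Or.inr hmult)
    (Or.inr (Or.inl hmult)) W' 448 D' (by norm_num) (by rw [habs]; norm_num) htw hadd' hopt'

/-- **C2 on `15a ⊗ χ₋₄` (level `240 = 2⁴·3·5`)**: `|c(D')| = 1 ∧ 2 ∤ c(D') ∧ 3 ∤ c(D')` on the `−1`-twist image of level `15`.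
[cite: CremonaAlgorithms1997, Table 1 (240c1)] -/
theorem shapes_on_family_fifteen_negOne
    (W : WeierstrassCurve ℚ) [W.IsElliptic] [W.IsGloballyMinimal] (D : ModularParametrizationData W 15)
    (hopt : ∀ z ∈ D.L.lattice, ∃ w ∈ periodLattice D.f, z = D.c * w)
    (hsemi : W.HasGoodReductionAtPrime 2 ∨ W.HasMultiplicativeReductionAtPrime 2)
    (W' : WeierstrassCurve ℚ) [W'.IsElliptic] [W'.IsGloballyMinimal] [NeZero (240 : ℕ)]
    (D' : ModularParametrizationData W' 240)
    (htw : IsIsogenous W' (W.quadraticTwist ((-1 : ℤ) : ℚ)))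
    (hadd' : ¬ W'.HasGoodReductionAtPrime 2 ∧ ¬ W'.HasMultiplicativeReductionAtPrime 2)
    (hopt' : ∀ z ∈ D'.L.lattice, ∃ w ∈ periodLattice D'.f, z = D'.c * w) :
    |D'.maninConstant| = 1 ∧ ¬ (2 : ℤ) ∣ D'.maninConstant ∧ ¬ (3 : ℤ) ∣ D'.maninConstant :=
  shapes_of_dyadicTwistLevelManinOne (dyadicTwistLevelManinOne_fifteen (Or.inl rfl)) W D hopt hsemi
    (Or.inl rfl) W' 240 D' (by norm_num) (by norm_num) htw hadd' hopt'

/-- **C2 on `15a ⊗ χ±8` (level `960 = 2⁶·3·5`)**: the same on the `±2`-twist image of the ODD level `15` (no `η`-clause).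
[cite: Stevens1989, Lemma (5.6)–(5.7)] -/
theorem shapes_on_family_fifteen_two {d : ℤ} (hd : d = 2 ∨ d = -2)
    (W : WeierstrassCurve ℚ) [W.IsElliptic] [W.IsGloballyMinimal] (D : ModularParametrizationData W 15)
    (hopt : ∀ z ∈ D.L.lattice, ∃ w ∈ periodLattice D.f, z = D.c * w)
    (hsemi : W.HasGoodReductionAtPrime 2 ∨ W.HasMultiplicativeReductionAtPrime 2)
    (W' : WeierstrassCurve ℚ) [W'.IsElliptic] [W'.IsGloballyMinimal] [NeZero (960 : ℕ)]
    (D' : ModularParametrizationData W' 960)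
    (htw : IsIsogenous W' (W.quadraticTwist (d : ℚ)))
    (hadd' : ¬ W'.HasGoodReductionAtPrime 2 ∧ ¬ W'.HasMultiplicativeReductionAtPrime 2)
    (hopt' : ∀ z ∈ D'.L.lattice, ∃ w ∈ periodLattice D'.f, z = D'.c * w) :
    |D'.maninConstant| = 1 ∧ ¬ (2 : ℤ) ∣ D'.maninConstant ∧ ¬ (3 : ℤ) ∣ D'.maninConstant :=
  have hd3 : d = -1 ∨ d = 2 ∨ d = -2 := Or.inr hd
  have habs : (4 * d.natAbs) ^ 2 = 64 := by rcases hd with rfl | rfl <;> rfl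
  shapes_of_dyadicTwistLevelManinOne (dyadicTwistLevelManinOne_fifteen hd3) W D hopt hsemi
    (Or.inr (Or.inr (Or.inr (by norm_num)))) W' 960 D' (by norm_num) (by rw [habs]; norm_num) htw hadd' hopt'

/-- **C3 on `14a ⊗ χ₋₃` (level `126 = 2·3²·7`, `9 ∥ N`)**: `|c(D')| = 1 ∧ 3 ∤ c(D')` for every lattice-optimal `X₀(126)`-datum
`D'` whose newform is the `χ`-twist (`χ` the primitive quadratic character mod `3`) of the newform of a lattice-optimal
`X₀(14)`-datum on a curve good or multiplicative at `3`.  No printed fact. [cite: CremonaAlgorithms1997, Table 1 (126a1)] -/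
theorem shapes_on_family_fourteen_three [Fact (Nat.Prime 3)]
    (χ : DirichletCharacter ℂ 3) (hχ : χ.IsQuadratic) (hprim : χ.IsPrimitive)
    (W : WeierstrassCurve ℚ) [W.IsElliptic] [W.IsGloballyMinimal] (D : ModularParametrizationData W 14)
    (hopt : ∀ z ∈ D.L.lattice, ∃ w ∈ periodLattice D.f, z = D.c * w)
    (hsemi : W.HasGoodReductionAtPrime 3 ∨ W.HasMultiplicativeReductionAtPrime 3)
    (W' : WeierstrassCurve ℚ) [W'.IsElliptic] [W'.IsGloballyMinimal] [NeZero (126 : ℕ)]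
    (D' : ModularParametrizationData W' 126)
    (hf : ∀ n : ℕ, cuspCoeff D'.f n = χ n * cuspCoeff D.f n)
    (hopt' : ∀ z ∈ D'.L.lattice, ∃ w ∈ periodLattice D'.f, z = D'.c * w) :
    |D'.maninConstant| = 1 ∧ ¬ (3 : ℤ) ∣ D'.maninConstant :=
  have h1 := twistLevelManinOne_fourteen (p := 3) (by norm_num) χ hχ hprim W D hopt hsemi W' 126 D'
    (by norm_num) (by norm_num) hf hopt'
  ⟨h1, not_dvd_of_abs_eq_one h1 (by decide)⟩

/-- **C3 on `15a ⊗ χ₋₃` (level `135 = 3³·5`, `27 ∣ N`)**: `|c(D')| = 1 ∧ 3 ∤ c(D')` on the `3`-twist image of level `15`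
(the carrier `15a` is MULTIPLICATIVE at `3`).  No printed fact. [cite: CremonaAlgorithms1997, Table 1 (135a1)] -/
theorem shapes_on_family_fifteen_three [Fact (Nat.Prime 3)]
    (χ : DirichletCharacter ℂ 3) (hχ : χ.IsQuadratic) (hprim : χ.IsPrimitive)
    (W : WeierstrassCurve ℚ) [W.IsElliptic] [W.IsGloballyMinimal] (D : ModularParametrizationData W 15)
    (hopt : ∀ z ∈ D.L.lattice, ∃ w ∈ periodLattice D.f, z = D.c * w)
    (hsemi : W.HasGoodReductionAtPrime 3 ∨ W.HasMultiplicativeReductionAtPrime 3)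
    (W' : WeierstrassCurve ℚ) [W'.IsElliptic] [W'.IsGloballyMinimal] [NeZero (135 : ℕ)]
    (D' : ModularParametrizationData W' 135)
    (hf : ∀ n : ℕ, cuspCoeff D'.f n = χ n * cuspCoeff D.f n)
    (hopt' : ∀ z ∈ D'.L.lattice, ∃ w ∈ periodLattice D'.f, z = D'.c * w) :
    |D'.maninConstant| = 1 ∧ ¬ (3 : ℤ) ∣ D'.maninConstant :=
  have h1 := twistLevelManinOne_fifteen (p := 3) (by norm_num) χ hχ hprim W D hopt hsemi W' 135 D'
    (by norm_num) (by norm_num) hf hopt'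
  ⟨h1, not_dvd_of_abs_eq_one h1 (by decide)⟩

end Summit.BirchSwinnertonDyer.BirchSwinnertonDyer.Theorems.ManinLocalTwoThree.TwistRootsFourteenFifteen

end
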